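import Literature.NumberTheory.Automorphic.TwistedQuotientIntFunHeckeReduction
import Literature.NumberTheory.Automorphic.TwistedQuotientRestrictScalars
import HarnessLib

/-!
# The directed family of scaled lattices `M_s = M + Σ_{c ∈ s} c·M` exhausting `V = K·M`

Topic `NumberTheory/Automorphic`; namespace `Literature.NumberTheory.Automorphic.TwistedQuotient`.
Definitions with bodies and theorems; no named fact, no instance, no `sorry`.

Let `k → K` be commutative rings, `V` a `K`-module, `π` a `K`-linear representation of `𝒢` on `V`
(regarded over `k` by `resScalars k π`), and `M ⊆ V` a `k`-submodule ("lattice") spanning `V` over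
`K`.  If `K` is much bigger than `Frac k` (e.g. `k = 𝒪_E`, `K = ℚ̄_p`), `V` is NOT the union of the
`k`-lattices `c⁻¹ M`, `c ∈ k`; but it is the directed union of the finitely generated lattices

  `scaledLattice M s = M + Σ_{c ∈ s} c • M`,  `s ⊂ K` finite,

(`exists_mem_scaledLattice`), each of which inherits from `M` finite generation
(`scaledLattice_fg`), stability under a level `L` (`scaledLattice_stable`), and congruences
"`π(g) m - m ∈ I·M`" (`sub_mem_smul_scaledLattice`, `modTrivialOn_scaledLattice`) — since `π(g)` is
`K`-linear, `π(g)(c m) - c m = c (π(g) m - m)`.  This is the device replacing "`p^t ξ` comes from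
`M̃_{E'}`" of [Scholze2015, §V.4, proof of Thm. V.4.1] when the rational class `ξ` is only given
with `ℚ̄_p`-coefficients: `ξ` comes from `H^q(X_U, M̃_s)` for some finite `s`
(`TwistedQuotientIndFunShapiroNatural.exists_map_indFunMap_eq_of_directed`).

## References

* P. Scholze, *On torsion in the cohomology of locally symmetric varieties*, Ann. of Math. 182
  (2015), §V.4, proof of Thm. V.4.1. [Scholze2015]
* K. S. Brown, *Cohomology of Groups*, GTM 87 (1982), VIII (4.6) (directed unions). [Brown1982CohomologyGroups]
-/

noncomputable section

open scoped Pointwise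

universe u

namespace Literature.NumberTheory.Automorphic

namespace TwistedQuotient

variable {k K : Type u} [CommRing k] [CommRing K] [Algebra k K] {V : Type u} [AddCommGroup V]
  [Module K V] [Module k V] [IsScalarTower k K V] (M : Submodule k V)

/-! ### The scaled lattices -/

/-- Multiplication by `c ∈ K` as a `k`-linear endomorphism of `V`. [folklore] -/
def scaleMap (c : K) : V →ₗ[k] V where
  toFun v := c • v
  map_add' v w := smul_add c v w
  map_smul' a v := smul_comm c a v

/-- Unfolding lemma. [folklore] -/
@[simp]
theorem scaleMap_apply (c : K) (v : V) : scaleMap (k := k) c v = c • v :=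
  rfl

/-- **The scaled lattice `M_s = M + Σ_{c ∈ s} c • M`** for a finite `s ⊂ K`. [folklore] -/
def scaledLattice (s : Finset K) : Submodule k V :=
  M ⊔ ⨆ c : (s : Set K), M.map (scaleMap (k := k) (c : K))

/-- `M ≤ M_s`. [folklore] -/
theorem le_scaledLattice (s : Finset K) : M ≤ scaledLattice M s :=
  le_sup_left

/-- `c • m ∈ M_s` for `c ∈ s`, `m ∈ M`. [folklore] -/
theorem smul_mem_scaledLattice {s : Finset K} {c : K} (hc : c ∈ s) {m : V} (hm : m ∈ M) :
    c • m ∈ scaledLattice M s := by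
  refine Submodule.mem_sup_right ?_
  have h : M.map (scaleMap (k := k) c) ≤ ⨆ c' : (s : Set K), M.map (scaleMap (k := k) (c' : K)) :=
    le_iSup (fun c' : (s : Set K) => M.map (scaleMap (k := k) (c' : K))) ⟨c, hc⟩
  exact h (Submodule.mem_map_of_mem hm)

/-- `M_s` is monotone in `s`. [folklore] -/
theorem scaledLattice_mono {s s' : Finset K} (h : s ⊆ s') : scaledLattice M s ≤ scaledLattice M s' := by
  refine sup_le (le_scaledLattice M s') (iSup_le fun c => ?_)
  rintro _ ⟨m, hm, rfl⟩
  exact smul_mem_scaledLattice M (h c.2) hm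

/-- **`M_s` is finitely generated** when `M` is. [folklore] -/
theorem scaledLattice_fg (hM : M.FG) (s : Finset K) : (scaledLattice M s).FG :=
  Submodule.FG.sup hM (Submodule.fg_iSup _ fun _ => hM.map _)

/-- Induction principle for membership in `M_s`: it suffices to treat `m ∈ M`, `c • m` (`c ∈ s`,
`m ∈ M`), `0` and sums. [folklore] -/
theorem scaledLattice_induction {s : Finset K} {C : V → Prop} (hmem : ∀ x ∈ M, C x)
    (hsmul : ∀ c ∈ s, ∀ m ∈ M, C (c • m)) (hzero : C 0) (hadd : ∀ x y, C x → C y → C (x + y))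
    {x : V} (hx : x ∈ scaledLattice M s) : C x := by
  obtain ⟨m, hm, y, hy, rfl⟩ := Submodule.mem_sup.1 hx
  refine hadd _ _ (hmem m hm) ?_
  refine Submodule.iSup_induction (fun c : (s : Set K) => M.map (scaleMap (k := k) (c : K)))
    (motive := C) hy (fun c z hz => ?_) hzero hadd
  obtain ⟨m', hm', rfl⟩ := hz
  exact hsmul c c.2 m' hm'

/-- The scaled lattices are submodules of a submodule `P` as soon as `M ≤ P` and `c • M ≤ P` for
`c ∈ s`. [folklore] -/
theorem scaledLattice_le {s : Finset K} {P : Submodule k V} (hMP : M ≤ P)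
    (hcP : ∀ c ∈ s, ∀ m ∈ M, c • m ∈ P) : scaledLattice M s ≤ P := fun _ hx =>
  scaledLattice_induction M (C := fun x => x ∈ P) (fun _ hm => hMP hm) hcP P.zero_mem
    (fun _ _ hx hy => P.add_mem hx hy) hx

/-- `c • M_s ≤ M_{s'}` for `s' ⊇ {c} ∪ c·s`. [folklore] -/
theorem smul_mem_scaledLattice_of_mem [DecidableEq K] {s : Finset K} (c : K) {x : V}
    (hx : x ∈ scaledLattice M s) :
    c • x ∈ scaledLattice M (insert c (s.image (c * ·))) := by
  refine scaledLattice_induction M (C := fun x => c • x ∈ scaledLattice M (insert c (s.image (c * ·))))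
    (fun m hm => smul_mem_scaledLattice M (Finset.mem_insert_self _ _) hm)
    (fun c' hc' m hm => ?_) (by rw [smul_zero]; exact Submodule.zero_mem _)
    (fun x y hx hy => by rw [smul_add]; exact Submodule.add_mem _ hx hy) hx
  rw [smul_smul]
  exact smul_mem_scaledLattice M (Finset.mem_insert_of_mem (Finset.mem_image_of_mem _ hc')) hm

/-- **The scaled lattices exhaust `V`** when `M` spans `V` over `K`. [folklore] -/
theorem exists_mem_scaledLattice (hspan : Submodule.span K (M : Set V) = ⊤) (v : V) :
    ∃ s : Finset K, v ∈ scaledLattice M s := by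
  classical
  have hv : v ∈ Submodule.span K (M : Set V) := by rw [hspan]; exact Submodule.mem_top
  induction hv using Submodule.span_induction with
  | mem x hx => exact ⟨∅, le_scaledLattice M ∅ hx⟩
  | zero => exact ⟨∅, Submodule.zero_mem _⟩
  | add x y _ _ hx hy =>
    obtain ⟨s, hs⟩ := hx
    obtain ⟨t, ht⟩ := hy
    exact ⟨s ∪ t, Submodule.add_mem _ (scaledLattice_mono M Finset.subset_union_left hs)
      (scaledLattice_mono M Finset.subset_union_right ht)⟩
  | smul c x _ hx =>
    obtain ⟨s, hs⟩ := hx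
    exact ⟨_, smul_mem_scaledLattice_of_mem M c hs⟩

/-- Two scaled lattices lie in a common one. [folklore] -/
theorem exists_scaledLattice_ge (s t : Finset K) :
    ∃ u : Finset K, scaledLattice M s ≤ scaledLattice M u ∧ scaledLattice M t ≤ scaledLattice M u := by
  classical
  exact ⟨s ∪ t, scaledLattice_mono M Finset.subset_union_left,
    scaledLattice_mono M Finset.subset_union_right⟩

/-! ### Stability and congruences -/

section Rep

variable {𝒢 : Type u} [Group 𝒢] (π : Representation K 𝒢 V) (L : Subgroup 𝒢)
  (hM : ∀ l ∈ L, ∀ m ∈ M, resScalars k π l m ∈ M)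

include hM in
/-- **`M_s` is `L`-stable** when `M` is (`π` being `K`-linear). [folklore] -/
theorem scaledLattice_stable (s : Finset K) :
    ∀ l ∈ L, ∀ x ∈ scaledLattice M s, resScalars k π l x ∈ scaledLattice M s := by
  intro l hl x hx
  refine scaledLattice_induction M (C := fun x => resScalars k π l x ∈ scaledLattice M s)
    (fun m hm => le_scaledLattice M s (hM l hl m hm)) (fun c hc m hm => ?_)
    (by rw [map_zero]; exact Submodule.zero_mem _)
    (fun x y hx hy => by rw [map_add]; exact Submodule.add_mem _ hx hy) hx
  rw [resScalars_apply, map_smul]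
  exact smul_mem_scaledLattice M hc (hM l hl m hm)

/-- **Congruences pass to `M_s`**: if a `K`-linear `g` preserves `M` with `g m - m ∈ I • M` for
`m ∈ M`, then `g x - x ∈ I • M_s` for `x ∈ M_s`. [cite: Scholze2015, §V.4 (proof of Thm. V.4.1)] -/
theorem sub_mem_smul_scaledLattice (I : Ideal k) (g : V →ₗ[K] V)
    (hI : ∀ m ∈ M, g m - m ∈ I • M) (s : Finset K) :
    ∀ x ∈ scaledLattice M s, g x - x ∈ I • scaledLattice M s := by
  intro x hx
  have hIM : I • M ≤ I • scaledLattice M s := Submodule.smul_mono le_rfl (le_scaledLattice M s)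
  refine scaledLattice_induction M (C := fun x => g x - x ∈ I • scaledLattice M s)
    (fun m hm => hIM (hI m hm)) (fun c hc m hm => ?_)
    (by rw [map_zero, sub_zero]; exact Submodule.zero_mem _)
    (fun x y hx hy => by
      rw [map_add, add_sub_add_comm]; exact Submodule.add_mem _ hx hy) hx
  rw [map_smul, ← smul_sub]
  have h1 : c • (g m - m) = scaleMap (k := k) c (g m - m) := rfl
  rw [h1]
  have h2 : (I • M).map (scaleMap (k := k) c) ≤ I • scaledLattice M s := by
    rw [Submodule.map_smul'']
    refine Submodule.smul_mono le_rfl ?_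
    rintro _ ⟨m', hm', rfl⟩
    exact smul_mem_scaledLattice M hc hm'
  exact h2 (Submodule.mem_map_of_mem (hI m hm))

include hM in
/-- **`ModTrivialOn` for `M_s`**: if `π(l) m - m ∈ (n) • M` for `l ∈ L ∩ L'`, `m ∈ M`, then the
lattice representation on `M_s` is trivial modulo `n` on `L'`. [cite: Scholze2015, §V.4 (proof of Thm. V.4.1)] -/
theorem modTrivialOn_scaledLattice (n : ℕ) (L' : Subgroup 𝒢)
    (hI : ∀ l ∈ L, l ∈ L' → ∀ m ∈ M, π l m - m ∈ (Ideal.span {(n : k)} : Ideal k) • M)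
    (s : Finset K) :
    ModTrivialOn (resScalars k π) (scaledLattice M s) (scaledLattice_stable M π L hM s) n L' := by
  intro l hl x
  have h := sub_mem_smul_scaledLattice M (Ideal.span {(n : k)}) (π l)
    (fun m hm => hI l l.2 hl m hm) s x x.2
  rw [Submodule.ideal_span_singleton_smul] at h
  obtain ⟨y, hy, hyx⟩ := Submodule.mem_smul_pointwise_iff_exists _ _ _ |>.1 h
  rw [mem_nsmulSubmodule_iff]
  refine ⟨⟨y, hy⟩, Subtype.ext ?_⟩
  rw [Submodule.coe_smul, Submodule.coe_sub, coe_latticeRep_apply, resScalars_apply]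
  exact hyx

end Rep

end TwistedQuotient

end Literature.NumberTheory.Automorphic
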